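import Summits.KontsevichZagierPeriods.KontsevichZagierPeriods.Theses.AyoubSpecialisation
import Summits.KontsevichZagierPeriods.KontsevichZagierPeriods.Theorems.TerasomaMultiplicationBetaCancellationOfPiCancellation

/-!
# `BetaCancellation` (stmt-13633) is item stmt-0540 AS FILED (`AyoubSpecialisation.AyoubPiCancellation`)

Helper file of the crux lead (`--supports` stmt-KontsevichZagierPeriods-13633). The tree proves
`BetaCancellationLine.betaCancellation_iff_piCancellation : BetaCancellation ↔ KZ.PiCancellation`
(closed-term `π`-cancellation of `KZProduct.lean`). Item stmt-0540 of route AyoubSpecialisation is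
filed in INTERFACE typing: for every family `P n r : IntegralRep (n + 2)` pinned as "unit disc in the
two leading coordinates, `r` in the trailing `n`", `FreeAbelianGroup.lift (of ∘ P) c ∈ relations →
c ∈ relations`. We identify the two: the pinned family exists (`[π] * r` reindexed from `Fin (2 + n)`
to `Fin (n + 2)`), any pinned family EQUALS it (the remaining fields of `IntegralRep` are proofs), and
`FreeAbelianGroup.lift (of ∘ P)` agrees with left multiplication by `[π]` modulo relations (a
coordinate relabelling is a rule-(2) move, `KZ.of_sub_of_reindex_mem_relations`). Hence
`stub_ayoubBridge : AyoubPiCancellation ↔ KZ.PiCancellation` (registered stub of the crux skeleton) and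
`betaCancellation_iff_ayoubPiCancellation : BetaCancellation ↔ AyoubPiCancellation`: the crux closes by
`betaCancellation_of_ayoubPiCancellation h0540` the moment item 0540 is proved in its own signature, and
a refutation of either item refutes the other.
-/

noncomputable section

-- `Summit.KontsevichZagierPeriods.KontsevichZagierPeriods.…` is the tree's mandated layout (single-conjunct summit).
set_option linter.dupNamespace false

namespace Summit.KontsevichZagierPeriods.KontsevichZagierPeriods.BetaCancellationLine

open Set
open Literature.NumberTheory.Transcendental
open Literature.NumberTheory.Transcendental.KZ
open Summit.KontsevichZagierPeriods.KontsevichZagierPeriods.Theses.TerasomaMultiplication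
  (BetaCancellation)
open Summit.KontsevichZagierPeriods.KontsevichZagierPeriods.Theses.AyoubSpecialisation
  (AyoubPiCancellation)
open Summit.KontsevichZagierPeriods.KontsevichZagierPeriods.BetaCancellationNegative
  (piCancellation_of_betaCancellation)

/-! ## The pinned family `[π] * r`, reindexed to `Fin (n + 2)` -/

/-- The coordinate relabelling `Fin (2 + n) ≃ Fin (n + 2)`. [folklore] -/
theorem piIndex_castAdd_zero (n : ℕ) :
    (finCongr (Nat.add_comm 2 n) (Fin.castAdd n (0 : Fin 2)) : Fin (n + 2)) = 0 :=
  Fin.ext (by simp)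

/-- The coordinate relabelling `Fin (2 + n) ≃ Fin (n + 2)` on the second disc coordinate. [folklore] -/
theorem piIndex_castAdd_one (n : ℕ) :
    (finCongr (Nat.add_comm 2 n) (Fin.castAdd n (1 : Fin 2)) : Fin (n + 2)) = 1 :=
  Fin.ext (by simp)

/-- The coordinate relabelling `Fin (2 + n) ≃ Fin (n + 2)` on the trailing coordinates. [folklore] -/
theorem piIndex_natAdd (n : ℕ) (j : Fin n) :
    (finCongr (Nat.add_comm 2 n) (Fin.natAdd 2 j) : Fin (n + 2)) = j.succ.succ :=
  Fin.ext (by simp)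

/-- **Domain of the reindexed `[π] * r`**: the pinning of item 0540. [folklore] -/
theorem piRep_prod_reindex_domain (n : ℕ) (r : IntegralRep n) :
    ((piRep.prod r).reindex (finCongr (Nat.add_comm 2 n))).domain =
      {z : Fin (n + 2) → ℝ | z 0 ^ 2 + z 1 ^ 2 ≤ 1 ∧ (fun i : Fin n => z i.succ.succ) ∈ r.domain} := by
  ext z
  simp only [IntegralRep.reindex_domain, IntegralRep.prod_domain, IntegralRep.mem_prodDomain,
    piRep_domain, mem_piDisc, mem_setOf_eq, piIndex_castAdd_zero, piIndex_castAdd_one, piIndex_natAdd]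

/-- **Integrand of the reindexed `[π] * r`**: the pinning of item 0540. [folklore] -/
theorem piRep_prod_reindex_integrand (n : ℕ) (r : IntegralRep n) :
    ((piRep.prod r).reindex (finCongr (Nat.add_comm 2 n))).integrand =
      fun z : Fin (n + 2) → ℝ => r.integrand (fun i : Fin n => z i.succ.succ) := by
  funext z
  simp only [IntegralRep.reindex_integrand, IntegralRep.piRep_prod_integrand, IntegralRep.prodFun,
    piRep_integrand, one_mul, piIndex_natAdd]

/-- **Uniqueness of the pinned family**: any `P` with the pinned domain and integrand IS the
reindexed `[π] * r` (the other fields of `IntegralRep` are proofs). [folklore] -/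
theorem pinned_eq_piRep_prod_reindex
    (P : ∀ n : ℕ, IntegralRep n → IntegralRep (n + 2))
    (hP : ∀ (n : ℕ) (r : IntegralRep n),
      (P n r).domain = {z : Fin (n + 2) → ℝ | z 0 ^ 2 + z 1 ^ 2 ≤ 1 ∧ (fun i : Fin n => z i.succ.succ) ∈ r.domain} ∧
      (P n r).integrand = fun z => r.integrand (fun i : Fin n => z i.succ.succ))
    (n : ℕ) (r : IntegralRep n) :
    P n r = (piRep.prod r).reindex (finCongr (Nat.add_comm 2 n)) :=
  IntegralRep.ext' ((hP n r).1.trans (piRep_prod_reindex_domain n r).symm)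
    ((hP n r).2.trans (piRep_prod_reindex_integrand n r).symm)

/-- **`lift (of ∘ P)` is `[π] * ·` modulo relations** for every pinned family `P`: on a generator
`[r]`, `[π] * [r] = [[π] × r]` differs from `[P r] = [([π] × r).reindex e]` by one rule-(2) move.
[folklore] -/
theorem piRep_mul_sub_lift_mem_relations
    (P : ∀ n : ℕ, IntegralRep n → IntegralRep (n + 2))
    (hP : ∀ (n : ℕ) (r : IntegralRep n),
      (P n r).domain = {z : Fin (n + 2) → ℝ | z 0 ^ 2 + z 1 ^ 2 ≤ 1 ∧ (fun i : Fin n => z i.succ.succ) ∈ r.domain} ∧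
      (P n r).integrand = fun z => r.integrand (fun i : Fin n => z i.succ.succ))
    (c : FormalRep) :
    of piRep * c - FreeAbelianGroup.lift (fun s : (Σ n, IntegralRep n) => of (P s.1 s.2)) c ∈ relations := by
  induction c using FreeAbelianGroup.induction_on with
  | zero => simp [relations.zero_mem]
  | of s =>
    obtain ⟨m, t⟩ := s
    rw [FreeAbelianGroup.lift_apply_of]
    change of piRep * of t - of (P m t) ∈ relations
    rw [of_mul_of, pinned_eq_piRep_prod_reindex P hP m t]
    exact of_sub_of_reindex_mem_relations _ _
  | neg s ih =>
    rw [mul_neg, map_neg, ← neg_sub']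
    exact relations.neg_mem ih
  | add x y hx hy =>
    rw [mul_add, map_add]
    have : of piRep * x + of piRep * y - (FreeAbelianGroup.lift (fun s : (Σ n, IntegralRep n) => of (P s.1 s.2)) x +
        FreeAbelianGroup.lift (fun s : (Σ n, IntegralRep n) => of (P s.1 s.2)) y) =
        (of piRep * x - FreeAbelianGroup.lift (fun s : (Σ n, IntegralRep n) => of (P s.1 s.2)) x) +
        (of piRep * y - FreeAbelianGroup.lift (fun s : (Σ n, IntegralRep n) => of (P s.1 s.2)) y) := by abel
    rw [this]
    exact relations.add_mem hx hy

/-- For a pinned family `P`: `lift (of ∘ P) c ∈ relations ↔ [π] * c ∈ relations`. [folklore] -/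
theorem lift_mem_relations_iff
    (P : ∀ n : ℕ, IntegralRep n → IntegralRep (n + 2))
    (hP : ∀ (n : ℕ) (r : IntegralRep n),
      (P n r).domain = {z : Fin (n + 2) → ℝ | z 0 ^ 2 + z 1 ^ 2 ≤ 1 ∧ (fun i : Fin n => z i.succ.succ) ∈ r.domain} ∧
      (P n r).integrand = fun z => r.integrand (fun i : Fin n => z i.succ.succ))
    (c : FormalRep) :
    FreeAbelianGroup.lift (fun s : (Σ n, IntegralRep n) => of (P s.1 s.2)) c ∈ relations ↔
      of piRep * c ∈ relations := by
  have h := piRep_mul_sub_lift_mem_relations P hP c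
  constructor
  · intro hc
    simpa using relations.add_mem h hc
  · intro hc
    have h' := relations.sub_mem hc h
    simpa using h'

/-- The pinned family exists: `P n r := ([π] × r).reindex (Fin (2 + n) ≃ Fin (n + 2))`. [folklore] -/
theorem exists_pinned :
    ∃ P : ∀ n : ℕ, IntegralRep n → IntegralRep (n + 2), ∀ (n : ℕ) (r : IntegralRep n),
      (P n r).domain = {z : Fin (n + 2) → ℝ | z 0 ^ 2 + z 1 ^ 2 ≤ 1 ∧ (fun i : Fin n => z i.succ.succ) ∈ r.domain} ∧
      (P n r).integrand = fun z => r.integrand (fun i : Fin n => z i.succ.succ) :=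
  ⟨fun n r => (piRep.prod r).reindex (finCongr (Nat.add_comm 2 n)),
    fun n r => ⟨piRep_prod_reindex_domain n r, piRep_prod_reindex_integrand n r⟩⟩

/-! ## Item 0540 as filed is `KZ.PiCancellation`; the crux is item 0540 -/

/-- **`AyoubPiCancellation ↔ KZ.PiCancellation`** (registered stub `stub_ayoubBridge` of the crux
skeleton, line `dirichlet-companion-to-pi`): item stmt-0540 in its interface typing is the
closed-term `π`-cancellation of `KZProduct.lean`. [folklore] -/
theorem stub_ayoubBridge :
    Summit.KontsevichZagierPeriods.KontsevichZagierPeriods.Theses.AyoubSpecialisation.AyoubPiCancellation ↔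
      Literature.NumberTheory.Transcendental.KZ.PiCancellation := by
  constructor
  · intro h c hc
    obtain ⟨P, hP⟩ := exists_pinned
    exact h P hP c ((lift_mem_relations_iff P hP c).2 hc)
  · intro h P hP c hc
    exact h c ((lift_mem_relations_iff P hP c).1 hc)

/-- **`BetaCancellation ↔ AyoubPiCancellation`**: the crux stmt-13633 of route TerasomaMultiplication
and the crux stmt-0540 of route AyoubSpecialisation, each in its filed signature, are equivalent
theorems-to-be: a proof or a refutation of either settles the other. [folklore] -/
theorem betaCancellation_iff_ayoubPiCancellation :
    Summit.KontsevichZagierPeriods.KontsevichZagierPeriods.Theses.TerasomaMultiplication.BetaCancellation ↔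
      Summit.KontsevichZagierPeriods.KontsevichZagierPeriods.Theses.AyoubSpecialisation.AyoubPiCancellation :=
  betaCancellation_iff_piCancellation.trans stub_ayoubBridge.symm

/-- **Closing term for the crux once item 0540 lands**: `AyoubPiCancellation → BetaCancellation`.
[folklore] -/
theorem betaCancellation_of_ayoubPiCancellation
    (h0540 : Summit.KontsevichZagierPeriods.KontsevichZagierPeriods.Theses.AyoubSpecialisation.AyoubPiCancellation) :
    Summit.KontsevichZagierPeriods.KontsevichZagierPeriods.Theses.TerasomaMultiplication.BetaCancellation :=
  betaCancellation_iff_ayoubPiCancellation.2 h0540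

/-- **Refutation transfer**: `¬ AyoubPiCancellation → ¬ BetaCancellation` (if item 0542 =
`AyoubNotPiCancellation` is ever proved, the crux is refuted by this term). [folklore] -/
theorem not_betaCancellation_of_not_ayoubPiCancellation
    (h : ¬ Summit.KontsevichZagierPeriods.KontsevichZagierPeriods.Theses.AyoubSpecialisation.AyoubPiCancellation) :
    ¬ Summit.KontsevichZagierPeriods.KontsevichZagierPeriods.Theses.TerasomaMultiplication.BetaCancellation :=
  fun hb => h (betaCancellation_iff_ayoubPiCancellation.1 hb)

end Summit.KontsevichZagierPeriods.KontsevichZagierPeriods.BetaCancellationLine
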